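import Literature.AlgebraicGeometry.ShimuraVarieties.UnitaryBallImageCompact
import Literature.AlgebraicGeometry.ShimuraVarieties.UnitaryBallDiscontinuity
import Literature.Geometry.ComplexHyperbolic.UnitBallQuotientManifold
import Literature.NumberTheory.Transcendental.AnalytificationSeparatedProofs
import Literature.AlgebraicGeometry.Motives.VarietiesProperProofs
import HarnessLib

/-!
# The compact complex surface `S(Γ) = Γ\𝔹²` of a compact ball-quotient datum

For a compact ball-quotient datum `D : UnitaryBallUniformisationDatum 2 X₂` (CM field `E ⊂ ℂ`, anisotropic
hermitian `H` of signature `(2,1)` at `τ₁`, torsion-free congruence subgroup `Γ`) and a Sylvester frame `𝔣`,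
the arithmetic lattice `Δ = ρ_𝔣(Γ) = D.ballImage 𝔣 ≤ U(2,1)` acts on the ball `𝔹²`
PROPERLY DISCONTINUOUSLY (`UnitaryBallDiscontinuity.finite_setOf_smul_mem`, Borel 1969 Prop. 7.13) and FREELY
(`eq_one_of_smul_eq`, torsion-freeness), and `U(2,1)/Δ` is compact
(`UnitaryBallImageCompact.instCompactSpaceQuotientBallImage`, Godement's criterion). Feeding these into the
generic file `Geometry/ComplexHyperbolic/UnitBallQuotientManifold` gives, as KERNEL instances:

* `instProperlyDiscontinuousSMulBallImage`, `instIsCancelSMulBallImage`;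
* `D.quotientSurface 𝔣 = Δ\𝔹²` (`MulAction.orbitRel.Quotient`) is a COMPACT, Hausdorff, path-connected COMPLEX
  MANIFOLD modelled on `𝓘(ℂ, ℂ²)` (`instIsManifoldQuotientSurface`, `instCompactSpaceQuotientSurface`, …) — the
  compact complex surface `S(Γ)` of Bergeron–Millson–Moeglin, Introduction §1.1, attached to the ALGEBRAIC data of
  the datum and the frame only (the fields `unif`, `X₂` are not read by these instances);
* the uniformisation of the datum descends to a HOMEOMORPHISM `D.quotientSurfaceHomeomorph 𝔣 : S(Γ) ≃ₜ X₂(ℂ)`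
  (`ballUnifMap` is continuous, onto, with fibres the `Γ`-orbits — `ballUnifMap_eq_iff`; a continuous bijection
  from a compact space to the Hausdorff space `X₂(ℂ)`), which is an ANALYTIFICATION in the tree's sense
  (`isAnalytification_quotientSurface : IsAnalytification (Fin 2 → ℂ) X₂ 2 (D.quotientSurfaceHomeomorph 𝔣)`:
  regular functions pull back to holomorphic functions on `Δ\𝔹²`), so that `S(Γ) ≅ X₂^an` canonically
  (`IsAnalytification.unique_holds`).

This is the manifold on which weight-`k` Poincaré series / holomorphic automorphic forms for `Δ`
(`BallForms.holFactorForms Δ (canonicalCocycle ℂ k)`) are sections of `K^{⊗k}`, i.e. the carrier of the projective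
embedding programme for `PicardCM.BallQuotientUniformised` (Shafarevich, BAG 2, IX §3.2).

References: A. Borel, *Introduction aux groupes arithmétiques* (1969), Prop. 7.13; N. Bergeron, J. Millson,
C. Moeglin, Acta Math. 216 (2016), Introduction §1.1; J. M. Lee, *Introduction to Smooth Manifolds*, Thm. 21.13.
Everything below is PROVED.
-/

set_option autoImplicit false

noncomputable section

open scoped Manifold ContDiff Topology
open Set Function MulAction Topology Matrix
open Literature.Geometry.ComplexHyperbolic Literature.Geometry.ComplexHyperbolic.BallModel

namespace Literature.AlgebraicGeometry.ShimuraVarieties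

namespace UnitaryBallUniformisationDatum

variable {X₂ : Motives.SchemeOver ℂ} (D : UnitaryBallUniformisationDatum 2 X₂) (𝔣 : D.SylvesterFrame)

/-- Membership in `Δ = ρ_𝔣(Γ)`: the elements of `D.ballImage 𝔣` are the `ρ_𝔣(γ)`, `γ ∈ Γ`.
[cite: BergeronMillsonMoeglin2016Balls, Introduction §1.1] -/
theorem mem_ballImage_iff {g : U21} : g ∈ D.ballImage 𝔣 ↔ ∃ γ : D.Γ, D.ballRep 𝔣 γ = g := by
  simp [ballImage, Subgroup.mem_map]

/-- `ρ_𝔣(γ)` as an element of `Δ = D.ballImage 𝔣`. [folklore] -/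
def ballImageMk (γ : D.Γ) : D.ballImage 𝔣 :=
  ⟨D.ballRep 𝔣 γ, (D.mem_ballImage_iff 𝔣).2 ⟨γ, rfl⟩⟩

/-- `ballImageMk γ` acts as `ρ_𝔣(γ)`. [cite: BergeronMillsonMoeglin2016Balls, Introduction §1.1] -/
@[simp] theorem ballImageMk_smul (γ : D.Γ) (z : Ball) : D.ballImageMk 𝔣 γ • z = D.ballRep 𝔣 γ • z := rfl

/-- `γ ↦ ρ_𝔣(γ) ∈ Δ` is onto. [cite: BergeronMillsonMoeglin2016Balls, Introduction §1.1] -/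
theorem ballImageMk_surjective : Function.Surjective (D.ballImageMk 𝔣) := by
  rintro ⟨g, hg⟩
  obtain ⟨γ, rfl⟩ := (D.mem_ballImage_iff 𝔣).1 hg
  exact ⟨γ, rfl⟩

/-- **`Δ = ρ_𝔣(Γ)` acts properly discontinuously on `𝔹²`** (from `finite_setOf_smul_mem`).
[cite: Borel1969, Prop. 7.13] -/
instance instProperlyDiscontinuousSMulBallImage : ProperlyDiscontinuousSMul (D.ballImage 𝔣) Ball :=
  BallModel.properlyDiscontinuousSMul_of_finite _ fun K L hK hL ↦ by
    refine ((D.finite_setOf_smul_mem 𝔣 hK hL).image (D.ballImageMk 𝔣)).subset ?_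
    intro δ hδ
    obtain ⟨γ, rfl⟩ := D.ballImageMk_surjective 𝔣 δ
    exact ⟨γ, hδ, rfl⟩

/-- **`Δ = ρ_𝔣(Γ)` acts freely on `𝔹²`** (from `eq_one_of_smul_eq`: `Γ` is torsion free).
[cite: BergeronMillsonMoeglin2016Balls, Introduction §1.1] -/
instance instIsCancelSMulBallImage : IsCancelSMul (D.ballImage 𝔣) Ball :=
  BallModel.isCancelSMul_of_smul_eq_imp _ fun δ z h ↦ by
    obtain ⟨γ, rfl⟩ := D.ballImageMk_surjective 𝔣 δ
    have hγ : γ = 1 := D.eq_one_of_smul_eq 𝔣 h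
    subst hγ
    exact Subtype.ext (map_one (D.ballRep 𝔣))

/-- **The quotient surface `S(Γ) = Δ\𝔹²`** of the datum in the frame `𝔣` (an orbit space; it reads only the
algebraic fields of `D` and the frame). [cite: BergeronMillsonMoeglin2016Balls, Introduction §1.1] -/
abbrev quotientSurface : Type := orbitRel.Quotient (D.ballImage 𝔣) Ball

/-- The projection `𝔹² → S(Γ)`. [folklore] -/
abbrev quotientSurfaceMk : Ball → D.quotientSurface 𝔣 :=
  Literature.Geometry.Manifold.QuotientManifold.mk (G := D.ballImage 𝔣) (M := Ball)

/-- **`S(Γ)` is a complex manifold** of dimension `2` (holomorphic atlas modelled on `ℂ²`).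
[cite: BergeronMillsonMoeglin2016Balls, Introduction §1.1] -/
instance instIsManifoldQuotientSurface : IsManifold 𝓘(ℂ, Fin 2 → ℂ) ω (D.quotientSurface 𝔣) :=
  BallModel.instIsManifoldQuotient _

/-- **`S(Γ)` is compact** (`U(2,1)/Δ` is compact: Godement's criterion, `H` anisotropic).
[cite: BergeronMillsonMoeglin2016Balls, Introduction §1.1] -/
instance instCompactSpaceQuotientSurface : CompactSpace (D.quotientSurface 𝔣) :=
  BallModel.compactSpace_quotient_of_compactSpace_quotientGroup _

/-- `S(Γ)` is Hausdorff. [folklore] -/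
instance instT2SpaceQuotientSurface : T2Space (D.quotientSurface 𝔣) :=
  BallModel.instT2SpaceQuotient _

/-- `S(Γ)` is path connected. [folklore] -/
instance instPathConnectedSpaceQuotientSurface : PathConnectedSpace (D.quotientSurface 𝔣) :=
  BallModel.instPathConnectedSpaceQuotient _

/-- The projection `𝔹² → S(Γ)` is holomorphic. [cite: BergeronMillsonMoeglin2016Balls, Introduction §1.1] -/
theorem contMDiff_quotientSurfaceMk :
    ContMDiff 𝓘(ℂ, Fin 2 → ℂ) 𝓘(ℂ, Fin 2 → ℂ) ω (D.quotientSurfaceMk 𝔣) :=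
  BallModel.contMDiff_mk _

/-- The projection `𝔹² → S(Γ)` is a local biholomorphism. [cite: BergeronMillsonMoeglin2016Balls, Introduction §1.1] -/
theorem isLocalDiffeomorph_quotientSurfaceMk :
    IsLocalDiffeomorph 𝓘(ℂ, Fin 2 → ℂ) 𝓘(ℂ, Fin 2 → ℂ) ω (D.quotientSurfaceMk 𝔣) :=
  BallModel.isLocalDiffeomorph_mk _

/-! ### `S(Γ) ≃ₜ X₂(ℂ)`: the uniformisation descends to the orbit space -/

/-- The uniformisation `ballUnifMap : 𝔹² → X₂(ℂ)` is constant on `Δ`-orbits, hence descends to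
`S(Γ) → X₂(ℂ)`. [cite: BergeronMillsonMoeglin2016Balls, Introduction §1.1] -/
def toComplexPoints : D.quotientSurface 𝔣 → Motives.ComplexPoints X₂ :=
  Quotient.lift (D.ballUnifMap 𝔣) fun z w hzw ↦ by
    obtain ⟨δ, rfl⟩ := MulAction.mem_orbit_iff.1 hzw
    obtain ⟨γ, rfl⟩ := D.ballImageMk_surjective 𝔣 δ
    rw [ballImageMk_smul, ballUnifMap_smul]

/-- `toComplexPoints ∘ mk = ballUnifMap`. [cite: BergeronMillsonMoeglin2016Balls, Introduction §1.1] -/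
@[simp] theorem toComplexPoints_mk (z : Ball) :
    D.toComplexPoints 𝔣 (D.quotientSurfaceMk 𝔣 z) = D.ballUnifMap 𝔣 z := rfl

/-- The descended uniformisation is continuous. [cite: BergeronMillsonMoeglin2016Balls, Introduction §1.1] -/
theorem continuous_toComplexPoints : Continuous (D.toComplexPoints 𝔣) :=
  Continuous.quotient_lift (D.continuous_ballUnifMap 𝔣) _

/-- The descended uniformisation is a bijection `S(Γ) → X₂(ℂ)` (onto: `ballUnifMap_surjective`; one-to-one:
the fibres of `ballUnifMap` are the `Γ`-orbits, `ballUnifMap_eq_iff`).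
[cite: BergeronMillsonMoeglin2016Balls, Introduction §1.1] -/
theorem bijective_toComplexPoints : Function.Bijective (D.toComplexPoints 𝔣) := by
  constructor
  · intro p q hpq
    obtain ⟨z, rfl⟩ := Quotient.exists_rep p
    obtain ⟨w, rfl⟩ := Quotient.exists_rep q
    change D.ballUnifMap 𝔣 z = D.ballUnifMap 𝔣 w at hpq
    obtain ⟨γ, hγ⟩ := (D.ballUnifMap_eq_iff 𝔣 z w).1 hpq
    refine Quotient.sound (MulAction.mem_orbit_iff.2 ⟨D.ballImageMk 𝔣 γ⁻¹, ?_⟩)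
    rw [ballImageMk_smul, ← hγ, map_inv, inv_smul_smul]
  · intro P
    obtain ⟨z, hz⟩ := D.ballUnifMap_surjective 𝔣 P
    exact ⟨D.quotientSurfaceMk 𝔣 z, hz⟩

/-- **`S(Γ) ≃ₜ X₂(ℂ)`**: the datum's uniformisation identifies the compact complex surface `Δ\𝔹²` with the
complex points of `X₂` HOMEOMORPHICALLY (a continuous bijection from a compact space onto a Hausdorff one;
`X₂(ℂ)` is Hausdorff because the smooth projective `X₂` is separated).
[cite: BergeronMillsonMoeglin2016Balls, Introduction §1.1] -/
def quotientSurfaceHomeomorph : D.quotientSurface 𝔣 ≃ₜ Motives.ComplexPoints X₂ :=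
  haveI : AlgebraicGeometry.IsProper X₂.hom := Motives.IsSmoothProjective.isProper_holds D.isSmoothProjective
  haveI : T2Space (Motives.ComplexPoints X₂) := Motives.ComplexPoints.t2Space_of_isSeparated X₂
  (D.continuous_toComplexPoints 𝔣).homeoOfEquivCompactToT2
    (f := Equiv.ofBijective _ (D.bijective_toComplexPoints 𝔣))

/-- The homeomorphism is the descended uniformisation. [cite: BergeronMillsonMoeglin2016Balls, Introduction §1.1] -/
@[simp] theorem quotientSurfaceHomeomorph_apply (p : D.quotientSurface 𝔣) :
    D.quotientSurfaceHomeomorph 𝔣 p = D.toComplexPoints 𝔣 p := rfl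

/-- In particular `X₂(ℂ)` is the continuous image of the compact surface: the uniformisation read through
`S(Γ)`, `quotientSurfaceHomeomorph ∘ mk = ballUnifMap`. [cite: BergeronMillsonMoeglin2016Balls, Introduction §1.1] -/
theorem quotientSurfaceHomeomorph_mk (z : Ball) :
    D.quotientSurfaceHomeomorph 𝔣 (D.quotientSurfaceMk 𝔣 z) = D.ballUnifMap 𝔣 z := rfl

/-! ### `S(Γ)` IS the analytification of `X₂` -/

/-- Regular functions of `X₂` pull back along `ballUnifMap` to holomorphic functions on the manifold `𝔹²`:
for an affine open `U ⊆ X₂` and `s ∈ Γ(X₂, U)`, `z ↦ s(ballUnifMap z)` (zero off `U`) is complex differentiable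
at every ball point mapping into `U` (the datum's clause `differentiableOn_unif`, composed with the affine
section `z ↦ T(z, 1)` of the frame). [cite: BergeronMillsonMoeglin2016Balls, Introduction §1.1]
[cite: SerreGAGA1956, §2 n°5 p. 9] -/
theorem mdifferentiableAt_evalOrZero_ballUnifMap (U : X₂.left.affineOpens)
    (s : X₂.left.presheaf.obj (Opposite.op (↑U : X₂.left.Opens))) {z : Ball}
    (hz : (D.ballUnifMap 𝔣 z).pt ∈ (↑U : X₂.left.Opens)) :
    MDifferentiableAt 𝓘(ℂ, Fin 2 → ℂ) 𝓘(ℂ, ℂ)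
      (fun w : Ball ↦ Motives.AlgPoints.evalOrZero (↑U : X₂.left.Opens) s (D.ballUnifMap 𝔣 w)) z := by
  have hO : IsOpen (D.cone ∩ D.unif ⁻¹' {P | P.pt ∈ (↑U : X₂.left.Opens)}) :=
    D.continuousOn_unif.isOpen_inter_preimage (isOpen_negCone _)
      (Motives.AlgPoints.isOpen_setOf_pt_mem _)
  have hc : 𝔣.t *ᵥ ![z.1 0, z.1 1, 1] ∈ D.cone := (D.coneLift 𝔣 z).2
  have hz' : 𝔣.t *ᵥ ![z.1 0, z.1 1, 1] ∈ D.unif ⁻¹' {P | P.pt ∈ (↑U : X₂.left.Opens)} := hz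
  have hF : DifferentiableAt ℂ
      ((fun v : Fin 3 → ℂ ↦ Motives.AlgPoints.evalOrZero (↑U : X₂.left.Opens) s (D.unif v)) ∘
        fun w : Fin 2 → ℂ ↦ 𝔣.t *ᵥ ![w 0, w 1, 1]) z.1 :=
    ((D.differentiableOn_unif U s).differentiableAt (hO.mem_nhds ⟨hc, hz'⟩)).comp z.1
      (D.differentiable_frameLift 𝔣).differentiableAt
  have hcomp : MDifferentiableAt 𝓘(ℂ, Fin 2 → ℂ) 𝓘(ℂ, ℂ)
      (((fun v : Fin 3 → ℂ ↦ Motives.AlgPoints.evalOrZero (↑U : X₂.left.Opens) s (D.unif v)) ∘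
        fun w : Fin 2 → ℂ ↦ 𝔣.t *ᵥ ![w 0, w 1, 1]) ∘ fun w : Ball ↦ (w.1 : Fin 2 → ℂ)) z :=
    (mdifferentiableAt_iff_differentiableAt.2 hF).comp z
      ((BallModel.contMDiff_coe (n := ω)).mdifferentiableAt (by simp))
  exact hcomp

/-- **`S(Γ)` is the analytification of `X₂`**: the homeomorphism `quotientSurfaceHomeomorph : Δ\𝔹² ≃ₜ X₂(ℂ)`,
with the quotient complex structure on `Δ\𝔹²` (model `ℂ²`, dimension `2`), satisfies the tree's
`IsAnalytification` — regular functions on affine opens pull back to holomorphic functions (they do on `𝔹²`,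
and the projection `𝔹² → Δ\𝔹²` is a surjective local biholomorphism). Consequently (by
`IsAnalytification.unique_holds`, GAGA §2 n°5 Prop. 2) `S(Γ)` is canonically biholomorphic to every Hodge model
`X₂^an`. [cite: SerreGAGA1956, §2 n°5 Prop. 2 (p. 8) and p. 9]
[cite: BergeronMillsonMoeglin2016Balls, Introduction §1.1] -/
theorem isAnalytification_quotientSurface :
    Literature.NumberTheory.Transcendental.IsAnalytification (Fin 2 → ℂ) X₂ 2
      (D.quotientSurfaceHomeomorph 𝔣) where
  isHomeomorph := (D.quotientSurfaceHomeomorph 𝔣).isHomeomorph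
  finrank_eq := by simp
  mdifferentiableOn_evalOrZero U s := by
    intro m hm
    refine MDifferentiableAt.mdifferentiableWithinAt ?_
    obtain ⟨z, rfl⟩ := Quotient.exists_rep m
    have hz : (D.ballUnifMap 𝔣 z).pt ∈ (↑U : X₂.left.Opens) := hm
    have hloc := D.isLocalDiffeomorph_quotientSurfaceMk 𝔣 z
    set g : D.quotientSurface 𝔣 → ℂ := fun m ↦
      Motives.AlgPoints.evalOrZero (↑U : X₂.left.Opens) s (D.quotientSurfaceHomeomorph 𝔣 m) with hg
    have h1 : MDifferentiableAt 𝓘(ℂ, Fin 2 → ℂ) 𝓘(ℂ, ℂ) (g ∘ D.quotientSurfaceMk 𝔣)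
        (hloc.localInverse (D.quotientSurfaceMk 𝔣 z)) := by
      rw [hloc.localInverse_left_inv hloc.localInverse_mem_target]
      exact D.mdifferentiableAt_evalOrZero_ballUnifMap 𝔣 U s hz
    have h2 : MDifferentiableAt 𝓘(ℂ, Fin 2 → ℂ) 𝓘(ℂ, ℂ)
        ((g ∘ D.quotientSurfaceMk 𝔣) ∘ hloc.localInverse) (D.quotientSurfaceMk 𝔣 z) :=
      h1.comp _ (hloc.localInverse_mdifferentiableAt (by simp))
    refine h2.congr_of_eventuallyEq ?_
    filter_upwards [hloc.localInverse_eventuallyEq_right] with y hy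
    simp only [Function.comp_apply, id_eq] at hy
    simp only [Function.comp_apply, hy]

end UnitaryBallUniformisationDatum

end Literature.AlgebraicGeometry.ShimuraVarieties

end
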